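import Summits.HodgeConjecture.HodgeConjecture.Theorems.Ring2DeformQbarFibreDescent
import Literature.AlgebraicGeometry.LaurentSchroer2023.ParaAbelianGroupLawHolds
import HarnessLib

/-!
# Ring 2 · route `deform`, XVI-e — the residual node R′ = `QbarFibreDescent` is a THEOREM: Laurent–Schröer's
# para-abelian descent is discharged over `ℚ̄`, and the `ℚ̄`-descent rows lose the binder `hLS`

HONEST FRAMING: research route conditional on HC_CM; not a corollary; Q11.4-sentence-2 already refuted in dim ≥ 3.

WHAT THIS PART DOES (and does not). Part XVI-d (`Ring2DeformQbarFibreDescent`) proved the node R′ =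
`QbarFibreDescent` of part XVI-c MODULO one named print fact, Laurent–Schröer's Prop. 4.3 over the field `ℚ̄`
(binder `hLS : LaurentSchroer2023.groupLaw_of_isParaAbelian_of_point (AlgebraicClosure ℚ)`). That fact is now a
Literature THEOREM for every algebraically closed ground field
(`LaurentSchroer2023.groupLaw_of_isParaAbelian_of_point_holds`, file
`Literature/AlgebraicGeometry/LaurentSchroer2023/ParaAbelianGroupLawHolds.lean`: spreading out of the group law to a
finitely generated `ℚ̄`-subalgebra of `ℂ`, EGA IV₃ 8.8.2, and specialisation at a `ℚ̄`-point — exactly the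
"equivalently" sentence of the docstring of `QbarFibreDescent`). Hence:
* `qbarFibreDescent_holds : QbarFibreDescent` — R′ is a theorem of the kernel, no hypothesis;
* the `ℚ̄`-descent rows of XVI-d re-based on FOUR named print facts {Voisin's `ℚ̄`-spread `hVo`, Deligne's partie
  fixe `hD`, Deligne 1982 Thm. 2.11 `hDel`, Catanese's abelian fibres `hCat`} (+ the seat's `hJ` on the arithmetic
  axis): `hE = QbarHodgeFamilies`, `HC_AV ↔ HC_QbarAV ∧ Q`, `HC_AV ↔ HC_CM ∧ L(𝔇) ∧ Q`, and THE ITEM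
  `CMToAbelian ↔ ModCM (L(𝔇) ∧ Q)` (stmt-HodgeConjecture-16267) — one binder fewer each, term reuse only.

HONEST COLUMN. (1) PROVED here: the six declarations below, kernel-checked, by instantiating XVI-d at the new Literature
theorem. (2) UNCHANGED and OPEN: `Q = QbarSpreading`, `HC_QbarAV`, `HC_CM`, `L(𝔇)`, and the four remaining print facts
(named Literature `def`s, cited, not asserted); stmt-HodgeConjecture-16267 stays OPEN; nothing here is a case of HC.
(3) New mathematics: none — bookkeeping consequence of a Literature discharge (pub-hodge-ring2 G2 row c30).
-/

set_option linter.dupNamespace false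

namespace Summit.HodgeConjecture.HodgeConjecture.Ring2.Deform

open Literature.AlgebraicGeometry Literature.AlgebraicGeometry.Motives
open Literature.AlgebraicGeometry.HodgeTheory
open Summit.HodgeConjecture.HodgeConjecture
open Summit.HodgeConjecture.HodgeConjecture.Theses
open Summit.HodgeConjecture.HodgeConjecture.Theses.RankFourFaces (CMAbelianHodge CMToAbelian)
open Summit.HodgeConjecture.HodgeConjecture.Theses.PadicSemiregularLift (HodgeAbelianVarieties)
open Summit.HodgeConjecture.HodgeConjecture.Ring2.AbelianAll (ModCM)

/-- **R′ = `QbarFibreDescent` holds (THEOREM, no hypothesis).** An abelian complex fibre `𝒳_t ≅ A'.X` over a point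
`t` of the `ℚ̄`-locus of a quasi-projective `ℚ̄`-family is the complexification of an abelian variety over
`ℚ^al ⊂ ℂ` of dimension `dim A'`: part XVI-d's `qbarFibreDescent_of_paraAbelianDescent` at the Literature theorem
`LaurentSchroer2023.groupLaw_of_isParaAbelian_of_point_holds ℚ̄` (Laurent–Schröer Prop. 4.3 over the algebraically
closed field `ℚ̄`, proved by spreading out and specialising the group law, EGA IV₃ 8.8.2).
[cite: LaurentSchroer2023, §4 Prop. 4.3 (case S = Spec k, k algebraically closed)] [cite: EGAIV3, Thm. 8.8.2] -/
theorem qbarFibreDescent_holds : QbarFibreDescent :=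
  qbarFibreDescent_of_paraAbelianDescent
    (LaurentSchroer2023.groupLaw_of_isParaAbelian_of_point_holds (AlgebraicClosure ℚ))

/-- **`hE = QbarHodgeFamilies` from FOUR named print facts** (Voisin's `ℚ̄`-spread, the partie fixe, Deligne 2.11,
Catanese's abelian fibres) — XVI-d's `qbarHodgeFamilies_of_printFacts` with `hLS` discharged.
[cite: Voisin2007HodgeLoci, §3 proof of Prop. 1.2, first paragraph (arXiv math/0605766 p. 6)]
[cite: Catanese2002DeformationTypes, §4 Thm. 4.1 and Thm. 4.6] -/
theorem qbarHodgeFamilies_of_fourPrintFacts (hVo : voisin2007_flatSpread_of_isAbsoluteHodgeClass)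
    (hD : deligne_globalInvariantCycles) (hDel : deligne1982_hodgeClasses_abelianVariety_absoluteHodge)
    (hCat : catanese2002_abelianFibres_of_abelianFibre) : QbarHodgeFamilies :=
  qbarHodgeFamilies_of_flatSpread_of_qbarFibreDescent hVo hD hDel hCat qbarFibreDescent_holds

/-- The same from the WEAKLY absolute spread (the form held by the bridge `QbarSummit`), `hLS` discharged.
[cite: Voisin2007HodgeLoci, Def. 2.1 and §3] -/
theorem qbarHodgeFamilies_of_weaklyAbsoluteFlatSpread_of_fourPrintFacts
    (hWS : voisin2007_flatSpread_of_isWeaklyAbsoluteHodgeClass) (hD : deligne_globalInvariantCycles)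
    (hDel : deligne1982_hodgeClasses_abelianVariety_absoluteHodge)
    (hCat : catanese2002_abelianFibres_of_abelianFibre) : QbarHodgeFamilies :=
  qbarHodgeFamilies_of_weaklyAbsoluteFlatSpread_of_qbarFibreDescent hWS hD hDel hCat qbarFibreDescent_holds

/-- **EXACTNESS of row Q modulo FOUR named print facts**: `HC_AV ↔ HC_QbarAV ∧ Q` (XVI-d's row with `hLS`
discharged). Both `HC_QbarAV` and `Q = QbarSpreading` are OPEN; neither is a case of HC in print.
[cite: Voisin2007HodgeLoci, §3 proof of Prop. 1.2 (p. 6)] [cite: Catanese2002DeformationTypes, §4 Thm. 4.1 and Thm. 4.6] -/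
theorem HC_AV_iff_hodgeConjectureQbarAV_and_qbarSpreading_of_fourPrintFacts
    (hVo : voisin2007_flatSpread_of_isAbsoluteHodgeClass) (hD : deligne_globalInvariantCycles)
    (hDel : deligne1982_hodgeClasses_abelianVariety_absoluteHodge)
    (hCat : catanese2002_abelianFibres_of_abelianFibre) :
    HodgeAbelianVarieties ↔ HodgeConjectureQbarAV ∧ QbarSpreading :=
  HC_AV_iff_hodgeConjectureQbarAV_and_qbarSpreading (qbarHodgeFamilies_of_fourPrintFacts hVo hD hDel hCat)

/-- **EXACTNESS on the arithmetic axis modulo FOUR named print facts**: `HC_AV ↔ HC_CM ∧ L(𝔇) ∧ Q` modulo [`hJ` =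
Milne 1999 Thm 7.1 + Deligne 1982 2.9(b); four named facts]. `HC_CM` is a hypothesis BY NAME and load-bearing.
[cite: Milne1999, §7 Thm. 7.1] [cite: Voisin2007HodgeLoci, §3 (p. 6)] -/
theorem HC_AV_iff_HC_CM_and_spanLifting_and_qbarSpreading_of_fourPrintFacts (𝔇 : RealizationFamily)
    (hJ : CMAbelianHodge → SpecialisationsAlgebraicAV 𝔇) (hVo : voisin2007_flatSpread_of_isAbsoluteHodgeClass)
    (hD : deligne_globalInvariantCycles) (hDel : deligne1982_hodgeClasses_abelianVariety_absoluteHodge)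
    (hCat : catanese2002_abelianFibres_of_abelianFibre) :
    HodgeAbelianVarieties ↔ CMAbelianHodge ∧ (SpanLiftingAtAlmostAllPrimesAV 𝔇 ∧ QbarSpreading) :=
  HC_AV_iff_HC_CM_and_spanLifting_and_qbarSpreading 𝔇 hJ (qbarHodgeFamilies_of_fourPrintFacts hVo hD hDel hCat)

/-- **THE ITEM EXACTLY, modulo FOUR named print facts**: `CMToAbelian ↔ ModCM (L(𝔇) ∧ Q)` —
stmt-HodgeConjecture-16267 — modulo [`hJ`; Voisin's spread, the partie fixe, Deligne 2.11, Catanese's abelian fibres].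
The item stays OPEN (`L(𝔇)` and `Q` are open). [cite: Milne1999, §7 Thm. 7.1] [cite: Voisin2007HodgeLoci, §3 (p. 6)] -/
theorem cmToAbelian_iff_modCM_spanLifting_and_qbarSpreading_of_fourPrintFacts (𝔇 : RealizationFamily)
    (hJ : CMAbelianHodge → SpecialisationsAlgebraicAV 𝔇) (hVo : voisin2007_flatSpread_of_isAbsoluteHodgeClass)
    (hD : deligne_globalInvariantCycles) (hDel : deligne1982_hodgeClasses_abelianVariety_absoluteHodge)
    (hCat : catanese2002_abelianFibres_of_abelianFibre) :
    CMToAbelian ↔ ModCM (SpanLiftingAtAlmostAllPrimesAV 𝔇 ∧ QbarSpreading) :=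
  cmToAbelian_iff_modCM_spanLifting_and_qbarSpreading 𝔇 hJ (qbarHodgeFamilies_of_fourPrintFacts hVo hD hDel hCat)

end Summit.HodgeConjecture.HodgeConjecture.Ring2.Deform
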